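import Summits.ResolutionOfSingularities.ResolutionOfSingularities.Theorems.FrobeniusClosingPatchingRelPerfectDepthLegalTraceN
import Literature.AlgebraicGeometry.Resolution.BlowupDisjointCentreWeights
import Literature.AlgebraicGeometry.Resolution.BlowupsProduct
import Literature.AlgebraicGeometry.Resolution.HypersurfaceRestriction
import Literature.AlgebraicGeometry.Resolution.EtaleVanishingIdeal
import Literature.AlgebraicGeometry.Resolution.CoefficientIdealRestriction
import Literature.AlgebraicGeometry.Resolution.MarkedIdealsEtale
import Literature.AlgebraicGeometry.Resolution.BlowupSNC
import Mathlib.CategoryTheory.ConcreteCategory.EpiMono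
import Mathlib.AlgebraicGeometry.Morphisms.IsIso
import HarnessLib

/-!
# Crux `PatchingRelPerfect` (stmt-ResolutionOfSingularities-16161), chain W5.2 — T6-E1b residual `LegalScopedDivisorReduction₃`,
# PHASE 2 closer (2b), D7 step 3: THE WAITING HOST COMPONENTS RIDE ALONG A CURVE MOVE

[OURS · L1 W5.2 · res-D-pv-052 g6 for the (2b) D7 closer, BY NAME from res-L1-w52-lead-1's `ORACLE-HANDOFF.md` (873ae9ed5877222f) §O4
and `PHASE2-STEPB-SPEC.md` D1 («the other components sit in an INERT factor; `τᶜ(N,0) = N𝒪` and its order-one generators persist off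
the centre»)] Replaces the role of NO printed item; NOT a statement of the manuscript under review; fact-free.

While the curve-move loop processes one integral host component `V(D)`, the other components `V(G)` (disjoint from `V(D)`, hence from
every centre `Z ⊆ V(D)`) are carried by plain pull-back `G ↦ G𝒪_{E′}` along the blowing up `τ : E′ → E` of `Z`.  Over `E ∖ Z ⊇ V(G)`
the blowing up is an isomorphism (Stacks 02OS), so everything the loop will need when `V(G)` becomes the active host survives:

* `exists_iso_subscheme_comap_of_disjoint` — an ISOMORPHISM `π_G : V(G𝒪) ⟶ V(G)` over `τ` (closed continuous bijection with bijective
  stalk maps: `IsBlowup.isIso_stalkMap_of_mem_support_of_disjoint`, `IsBlowup.image_support_comap_of_disjoint`);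
* `comap_monomialIdeal_le_stepExp` — `M𝒪 ≤ M′` for the new boundary monomial `M′ = monomialIdeal (stepExp L τ 𝓘(Z) (w − 1))`
  (`M𝒪 = (𝓘(Z)𝒪)^w · ∏ strict transforms`, `w ≥ 1`);
* `exists_sncd_trace_comap_of_disjoint` — the entry invariant `Inv₃` of a waiting component survives: the strict normal crossings
  divisor `BX ⊇ Supp (M|_{V(G)})` pulls back along `π_G` to one containing `Supp (M′|_{V(G𝒪)})`;
* `disjoint_support_comap_stepExp_of_disjoint` — a component already separated from the positive boundary stays separated
  (strict transforms lie over the old members, the exceptional divisor over `V(D)`);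
* the regular / reduced / irreducible / effective-Cartier clauses are the tree's `IsBlowup.isRegular_subscheme_comap_of_disjoint`,
  `comap_eq_vanishingIdeal_of_disjoint`, `isIrreducible_support_comap_of_disjoint`, `IsEffectiveCartier.comap_of_isBlowup`
  (`BlowupDisjointCentreWeights`, `BlowupsProduct`) and are only re-exported in bundled form (`WaitingPiece.step`).

AI-written; AI review is weaker than expert review.

## References
* The Stacks Project, Tags 02OS, 080A, 01J7. [StacksProject]
* U. Görtz, T. Wedhorn, *Algebraic Geometry I* (2nd ed. 2020), Prop. 13.91 (3). [GortzWedhorn2020]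
* E. Bierstone, D. Grigoriev, P. Milman, J. Włodarczyk, arXiv:1206.3090, Lemma 3.7.1, §4 Step 2. [BierstoneGrigorievMilmanWlodarczyk2011]
-/

-- `Summit.<Summit>.<Sub>.Theorems` with `Sub = Summit` (single-conjunct summit, D-0017)
set_option linter.dupNamespace false

noncomputable section

open CategoryTheory CategoryTheory.Limits AlgebraicGeometry TopologicalSpace IsLocalRing Topology
open Literature.AlgebraicGeometry.Resolution Scheme.IdealSheafData

namespace Summit.ResolutionOfSingularities.ResolutionOfSingularities.Theorems

universe u

namespace DepthLegal

open WeightTwoB DepthTargets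

/-! ## §1 The isomorphism `V(G𝒪) ≅ V(G)` for a closed subscheme off the centre -/

section Iso

variable {E E₁ : Scheme.{u}} [IsLocallyNoetherian E] {τ : E₁ ⟶ E} {C G : E.IdealSheafData}

/-- [OURS · L1 W5.2] **Blowing up away from `V(G)` does not change `V(G)`**: for a blowing up `τ` along `C` with `V(C) ∩ V(G) = ∅` there is
an ISOMORPHISM `π_G : V(G𝒪_{E₁}) ⟶ V(G)` with `π_G ≫ ι_G = ι_{G𝒪} ≫ τ` (module docstring). [cite: StacksProject, Tag 02OS]
[cite: GortzWedhorn2020, Prop. 13.91 (3)] -/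
theorem exists_iso_subscheme_comap_of_disjoint (hτ : IsBlowup τ C) (hd : Disjoint (C.support : Set E) (G.support : Set E)) :
    ∃ πG : (G.comap τ).subscheme ⟶ G.subscheme, πG ≫ G.subschemeι = (G.comap τ).subschemeι ≫ τ ∧ IsIso πG := by
  haveI : IsProper τ := hτ.isProper
  -- the morphism over `τ`
  have hker : G.subschemeι.ker ≤ ((G.comap τ).subschemeι ≫ τ).ker := by
    rw [Scheme.IdealSheafData.ker_subschemeι, le_ker_iff_comap_eq_bot, Scheme.IdealSheafData.comap_comp]
    exact comap_subschemeι_self _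
  refine ⟨IsClosedImmersion.lift _ _ hker, IsClosedImmersion.lift_fac _ _ hker, ?_⟩
  set πG := IsClosedImmersion.lift G.subschemeι ((G.comap τ).subschemeι ≫ τ) hker with hπGdef
  have hsq : πG ≫ G.subschemeι = (G.comap τ).subschemeι ≫ τ := IsClosedImmersion.lift_fac _ _ hker
  have hpt : ∀ x', G.subschemeι (πG x') = τ ((G.comap τ).subschemeι x') := fun x' => by
    rw [← Scheme.Hom.comp_apply, hsq]; rfl
  -- the points of `V(G𝒪)` lie off the centre, where `τ` is injective
  have hoff : ∀ x', τ ((G.comap τ).subschemeι x') ∈ (G.support : Set E) := fun x' =>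
    (mem_support_comap_iff τ G _).mp (subschemeι_apply_mem_support (G.comap τ) x')
  have hinjτ : ∀ y₁ y₂ : E₁, τ y₁ ∈ (G.support : Set E) → τ y₂ ∈ (G.support : Set E) → τ y₁ = τ y₂ → y₁ = y₂ := by
    intro y₁ y₂ h₁ h₂ h
    haveI : IsIso (τ ∣_ centreCompl C) := hτ.isIso_compl
    have h₁' : y₁ ∈ τ ⁻¹ᵁ centreCompl C := support_subset_centreCompl_of_disjoint hd h₁
    have h₂' : y₂ ∈ τ ⁻¹ᵁ centreCompl C := support_subset_centreCompl_of_disjoint hd h₂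
    have heq : (τ ∣_ centreCompl C) ⟨y₁, h₁'⟩ = (τ ∣_ centreCompl C) ⟨y₂, h₂'⟩ := by
      apply Subtype.ext
      simpa [morphismRestrict_base_coe] using h
    exact congrArg Subtype.val ((τ ∣_ centreCompl C).homeomorph.injective heq)
  -- (i) `π_G` is a closed continuous bijection, hence an open embedding
  have hinj : Function.Injective πG.base := by
    intro x₁ x₂ h
    have h1 : τ ((G.comap τ).subschemeι x₁) = τ ((G.comap τ).subschemeι x₂) := by rw [← hpt, ← hpt]; exact congrArg _ h
    exact (G.comap τ).subschemeι.isClosedEmbedding.injective (hinjτ _ _ (hoff x₁) (hoff x₂) h1)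
  have hsurj : Function.Surjective πG.base := by
    intro y
    have hy : G.subschemeι y ∈ τ '' ((G.comap τ).support : Set E₁) := by
      rw [hτ.image_support_comap_of_disjoint hd]; exact subschemeι_apply_mem_support G y
    obtain ⟨z, hz, hzy⟩ := hy
    have hz' : z ∈ Set.range (G.comap τ).subschemeι.base := by rw [Scheme.IdealSheafData.range_subschemeι]; exact hz
    obtain ⟨x', rfl⟩ := hz'
    refine ⟨x', G.subschemeι.isClosedEmbedding.injective ?_⟩
    rw [hpt]; exact hzy
  have hclosed : IsClosedMap πG.base := by
    intro A hA
    have hA' : IsClosed (τ.base '' ((G.comap τ).subschemeι.base '' A)) :=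
      τ.isClosedMap _ ((G.comap τ).subschemeι.isClosedEmbedding.isClosedMap _ hA)
    have heq : πG.base '' A = G.subschemeι.base ⁻¹' (τ.base '' ((G.comap τ).subschemeι.base '' A)) := by
      ext y
      constructor
      · rintro ⟨x', hx', rfl⟩
        exact ⟨_, ⟨x', hx', rfl⟩, (hpt x').symm⟩
      · rintro ⟨_, ⟨x', hx', rfl⟩, hy⟩
        refine ⟨x', hx', G.subschemeι.isClosedEmbedding.injective ?_⟩
        rw [hpt]; exact hy
    rw [heq]
    exact hA'.preimage G.subschemeι.base.hom.continuous
  have hce : IsClosedEmbedding πG.base := .of_continuous_injective_isClosedMap πG.base.hom.continuous hinj hclosed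
  have hoe : IsOpenEmbedding πG.base := ⟨hce.isEmbedding, by rw [hsurj.range_eq]; exact isOpen_univ⟩
  -- (ii) the stalk maps are bijective
  haveI : ∀ x', IsIso (πG.stalkMap x') := by
    intro x'
    have hsurjG : Function.Surjective (G.subschemeι.stalkMap (πG x')).hom := G.subschemeι.stalkMap_surjective _
    have hkerG : RingHom.ker (G.subschemeι.stalkMap (πG x')).hom = stalkIdeal G (G.subschemeι (πG x')) :=
      ker_stalkMap_subschemeι G (πG x')
    have hcomp : ((πG ≫ G.subschemeι).stalkMap x').hom = (πG.stalkMap x').hom.comp (G.subschemeι.stalkMap (πG x')).hom := by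
      rw [Scheme.Hom.stalkMap_comp]; rfl
    -- along the other path `ι' ≫ τ`: a surjection with kernel `G_{τ y}` (the stalk map of `τ` at `y = ι' x'` is bijective)
    haveI hisoτ : IsIso (τ.stalkMap ((G.comap τ).subschemeι x')) := hτ.isIso_stalkMap_of_mem_support_of_disjoint hd (hoff x')
    have hbijτ : Function.Bijective (τ.stalkMap ((G.comap τ).subschemeι x')).hom := ConcreteCategory.bijective_of_isIso _
    have hsurjψ : Function.Surjective ((πG ≫ G.subschemeι).stalkMap x').hom := by
      rw [hsq, Scheme.Hom.stalkMap_comp]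
      exact ((G.comap τ).subschemeι.stalkMap_surjective x').comp hbijτ.2
    have hkerψ : RingHom.ker ((πG ≫ G.subschemeι).stalkMap x').hom = stalkIdeal G ((πG ≫ G.subschemeι) x') := by
      rw [hsq, Scheme.Hom.stalkMap_comp]
      change RingHom.ker (((G.comap τ).subschemeι.stalkMap x').hom.comp (τ.stalkMap ((G.comap τ).subschemeι x')).hom) = _
      rw [← RingHom.comap_ker, ker_stalkMap_subschemeι (G.comap τ) x', stalkIdeal_comap_eq_map,
        Ideal.comap_map_of_bijective _ hbijτ]
      rfl
    have hkk : RingHom.ker ((πG ≫ G.subschemeι).stalkMap x').hom = RingHom.ker (G.subschemeι.stalkMap (πG x')).hom :=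
      hkerψ.trans hkerG.symm
    refine (ConcreteCategory.isIso_iff_bijective _).mpr ⟨?_, ?_⟩
    · rw [injective_iff_map_eq_zero]
      intro a ha
      obtain ⟨r, rfl⟩ := hsurjG a
      have h1 : ((πG ≫ G.subschemeι).stalkMap x').hom r = 0 := by
        rw [hcomp]; exact ha
      have h2 := (SetLike.ext_iff.mp hkk r).mp (RingHom.mem_ker.mpr h1)
      exact RingHom.mem_ker.mp h2
    · intro b
      obtain ⟨r, hr⟩ := hsurjψ b
      refine ⟨(G.subschemeι.stalkMap (πG x')).hom r, ?_⟩
      have h1 : ((πG ≫ G.subschemeι).stalkMap x').hom r = (πG.stalkMap x').hom ((G.subschemeι.stalkMap (πG x')).hom r) := by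
        rw [hcomp]; rfl
      exact h1 ▸ hr
  have hopen : IsOpenImmersion πG := IsOpenImmersion.of_isIso_stalkMap πG hoe
  exact (isIso_iff_isOpenImmersion_and_surjective πG).mpr ⟨hopen, ⟨hsurj⟩⟩

end Iso

/-! ## §2 The new boundary monomial dominates the pulled-back old one -/

section Monomial

variable {E E' : Scheme.{u}} [IsLocallyNoetherian E] {τ : E' ⟶ E} {Z : Closeds E} {η : E} {L : List (E.IdealSheafData × ℕ)}

/-- `M𝒪 ≤ monomialIdeal (stepExp L τ 𝓘(Z) (w − 1))` with `w = weightAt L η ≥ 1` the weight at the generic point of the centre: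
`M𝒪 = (𝓘(Z)𝒪)^w · ∏ strict transforms` (`comap_monomialIdeal_single`). [cite: Kollar2007, (3.111) Step 1] -/
theorem comap_monomialIdeal_le_stepExp (hη : IsGenericPoint η (Z : Set E)) (hnc : HasSNCWith (boundaryOf L) (vanishingIdeal Z))
    (hτ : IsBlowup τ (vanishingIdeal Z)) (hw : 1 ≤ weightAt L η) :
    (monomialIdeal L).comap τ ≤ monomialIdeal (stepExp L τ (vanishingIdeal Z) (weightAt L η - 1)) := by
  rw [comap_monomialIdeal_single hη hnc hτ, monomialIdeal_stepExp]
  obtain ⟨k, hk⟩ := Nat.exists_eq_add_of_le hw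
  rw [hk, Nat.add_sub_cancel_left, pow_add, pow_one, mul_comm _ ((vanishingIdeal Z).comap τ ^ k), mul_assoc,
    mul_comm (monomialIdeal _)]
  exact mul_le_mul' le_rfl (HostStateN.mul_le_of_inert _ _)

end Monomial

/-! ## §3 Transport of the waiting components' clauses along one curve move -/

section Transport

variable {E E' : Scheme.{u}} [IsLocallyNoetherian E] {τ : E' ⟶ E} {Z : Closeds E} {η : E}
  {D G : E.IdealSheafData} {L : List (E.IdealSheafData × ℕ)}

/-- **`Inv₃` of a waiting component survives a move inside the active host**: if `V(G)` misses `V(D) ⊇ Z` and the trace `M|_{V(G)}` lies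
in a strict normal crossings divisor of `V(G)`, then the trace `M′|_{V(G𝒪)}` of the new boundary monomial lies in a strict normal crossings
divisor of `V(G𝒪)` (pull-back along the isomorphism `π_G`; `M𝒪 ≤ M′`). [cite: StacksProject, Tag 02OS] [cite: DeJong1996, 2.4] -/
theorem exists_sncd_trace_comap_of_disjoint (hη : IsGenericPoint η (Z : Set E))
    (hnc : HasSNCWith (boundaryOf L) (vanishingIdeal Z)) (hτ : IsBlowup τ (vanishingIdeal Z)) (hw : 1 ≤ weightAt L η)
    (hZD : (Z : Set E) ⊆ D.support) (hGD : Disjoint (G.support : Set E) D.support)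
    (h : ∃ BX : Set G.subscheme, IsStrictNormalCrossingsDivisor G.subscheme BX ∧
      (((monomialIdeal L).comap G.subschemeι).support : Set G.subscheme) ⊆ BX) :
    ∃ BX' : Set (G.comap τ).subscheme, IsStrictNormalCrossingsDivisor (G.comap τ).subscheme BX' ∧
      (((monomialIdeal (stepExp L τ (vanishingIdeal Z) (weightAt L η - 1))).comap (G.comap τ).subschemeι).support :
        Set (G.comap τ).subscheme) ⊆ BX' := by
  obtain ⟨BX, hBX, hT⟩ := h
  have hd : Disjoint ((vanishingIdeal Z).support : Set E) (G.support : Set E) := by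
    rw [Scheme.IdealSheafData.coe_support_vanishingIdeal]
    exact Set.disjoint_of_subset_left hZD hGD.symm
  obtain ⟨πG, hsq, hiso⟩ := exists_iso_subscheme_comap_of_disjoint hτ hd
  haveI := hiso
  haveI : IsLocallyNoetherian G.subscheme := LocallyOfFiniteType.isLocallyNoetherian G.subschemeι
  refine ⟨πG.base ⁻¹' BX, hBX.preimage_of_etale πG, fun x' hx' => hT ?_⟩
  -- `Supp (M′|) ⊆ Supp (M𝒪|) = π_G⁻¹ Supp (M|)`
  have h1 : x' ∈ (((monomialIdeal L).comap τ).comap (G.comap τ).subschemeι).support :=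
    support_antitone (Scheme.IdealSheafData.comap_mono (f := (G.comap τ).subschemeι)
      (comap_monomialIdeal_le_stepExp hη hnc hτ hw)) hx'
  rw [← Scheme.IdealSheafData.comap_comp, ← hsq, Scheme.IdealSheafData.comap_comp] at h1
  exact (mem_support_comap_iff πG _ x').mp h1

omit [IsLocallyNoetherian E] in
/-- **A separated component stays separated**: if `V(G)` misses `V(D) ⊇ Z` and every positive-exponent member of `L`, then `V(G𝒪)`
misses every positive-exponent member of `stepExp L τ 𝓘(Z) e` (strict transforms lie over their members, the exceptional divisor over `Z`).
[cite: BierstoneGrigorievMilmanWlodarczyk2011, §4 Step 2] -/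
theorem disjoint_support_comap_stepExp_of_disjoint (hZD : (Z : Set E) ⊆ D.support) (hGD : Disjoint (G.support : Set E) D.support)
    (hGL : ∀ p ∈ L, 0 < p.2 → Disjoint (G.support : Set E) p.1.support) (e : ℕ) :
    ∀ p ∈ stepExp L τ (vanishingIdeal Z) e, 0 < p.2 → Disjoint ((G.comap τ).support : Set E') p.1.support := by
  intro p hp hpos
  rw [Set.disjoint_left]
  intro x' hxG hxp
  have hxG' : τ x' ∈ (G.support : Set E) := (mem_support_comap_iff τ G x').mp hxG
  simp only [stepExp, List.mem_append, List.mem_map, List.mem_singleton] at hp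
  rcases hp with ⟨q, hq, rfl⟩ | rfl
  · -- a strict transform: it lies over its member
    have h1 : τ x' ∈ q.1.support := mem_support_of_mem_support_strictTransformIdeal hxp
    exact Set.disjoint_left.mp (hGL q hq hpos) hxG' h1
  · -- the exceptional divisor: it lies over `Z ⊆ V(D)`
    have h1 : τ x' ∈ ((vanishingIdeal Z).support : Set E) := (mem_support_comap_iff τ _ x').mp hxp
    rw [Scheme.IdealSheafData.coe_support_vanishingIdeal] at h1
    exact Set.disjoint_left.mp hGD hxG' (hZD h1)

omit [IsLocallyNoetherian E] in
/-- Disjointness from the new host: `Supp (G𝒪) ∩ Supp τᶜ(D,1) = ∅` (`Supp τᶜ(D,1) ⊆ τ⁻¹ Supp D`). [folklore] -/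
theorem disjoint_support_comap_controlledTransform (hGD : Disjoint (G.support : Set E) D.support) (C : E.IdealSheafData) :
    Disjoint ((G.comap τ).support : Set E') (controlledTransform τ C D 1).support := by
  rw [Set.disjoint_left]
  intro x' hxG hxD
  have h1 : τ x' ∈ G.support := (mem_support_comap_iff τ G x').mp hxG
  have h2 : τ x' ∈ D.support := by
    have h := support_antitone (comap_le_controlledTransform τ C D 1) hxD
    exact (mem_support_comap_iff τ D x').mp h
  exact Set.disjoint_left.mp hGD h1 h2

end Transport

end DepthLegal

end Summit.ResolutionOfSingularities.ResolutionOfSingularities.Theorems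

end
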